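import Mathlib
import HarnessLib
import HarnessLib.Audit
import Summits.Langlands.Statement
import Literature.NumberTheory.GaloisRepresentations.GSpValued
import Literature.NumberTheory.GaloisRepresentations.CrystallineOrdinaryShape
import Literature.NumberTheory.GaloisRepresentations.AbsolutelyIrreducibleReduction
import Literature.NumberTheory.Automorphic.HodgeInfinityType
import HarnessLib.Audit.Status.Attr

/-!
Route: GSpinCensusRung

DORMANT since 2026-08-22T15:39:30Z (reconciler: no traction for 5.5 d (last activity item-evidence-added at 2026-08-17T04:13:53Z); parked, not closed — `ledger route dormant route-Langlands-GSpinCensusRung --off` to reactivate) — unstaffed, not closed; items shared with open routes are served there. `ledger route dormant <id> --off` reactivates.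

# Route GSpinCensusRung — the (1,2,2,1) symplectic rung — potential automorphy of rank-6 symplectic
motives of Hodge type (1,2,2,1) as non-degenerate limits on GSpin(2,5)

Route GSpinCensusRung realises idea card cy3-h21-two-gspin-census (gen 2; the gen-1 route GSpinRung
was retired `not-a-thesis`
because its assembly stopped at the province; this route's deciding theorem `closes` concludes
`_root_.Langlands`). It suffices to
show X = RungTarget together with the two (A)-side items: X := POTENTIAL WEAK AUTOMORPHY OF THE
ORDINARY RANK-6 SYMPLECTIC PROVINCE OF
HODGE TYPE (1,2,2,1). For F totally real and a prime p > 13 split completely in F, every ρ : Γ_F →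
GL_6(ℚ̄_p) that is irreducible,
unramified almost everywhere, odd, GSp_6-valued (`FramedRep.IsGSpValued`), GREENBERG-ordinary of
inertial shape (0,1,1,2,2,3) and
residually distinguished at every v ∣ p (`IsGreenbergOrdinaryOfShapeAt`,
`IsResiduallyDistinguishedAt`: Hodge–Tate weights
{0,1,1,2,2,3} = H³ of a Calabi–Yau threefold with h^{2,1} = 2 at an ordinary prime, a weight-3
rank-6 hypergeometric motive of Hodge
vector (1,2,2,1), the anchors ρ_f ⊗ Sym² ρ_g), with ρ̄|Γ_{F(ζ_p)} absolutely irreducible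
(`HasAbsolutelyIrreducibleReduction`), becomes
over some finite Galois totally real F'/F on which it stays irreducible WEAKLY AUTOMORPHIC OF THE
RIGHT WEIGHT: there is a cuspidal π'
of GL_6(𝔸_{F'}) of pure Hodge infinity type (3; 0,1,1,2,2,3) (`HasHodgeInfinityType`, NOT regular)
with Satake–Frobenius matching at
almost all places (the summit's `SatakeFrobCompatibleAt`). X follows by pure logic from the cruxes
SingularWeightLifting (rank 2) and
MoretBaillySeed (rank 3); LimitWeightGaloisRep (rank 4) is the (A)-half of the province; the support
BeyondTheRung is the honest
remainder X → Langlands. All statements are datum-free GL_6-shadows over the accepted API and the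
four definition files that landed
for this card (GSpValued, CrystallineOrdinaryShape, AbsolutelyIrreducibleReduction,
HodgeInfinityType).
Lean: `∀ (F : Type) [Field F] [NumberField F] [NumberField.IsTotallyReal F] (p : ℕ) [Fact p.Prime]
(ι : PadicAlgCl p ≃+* ℂ) (ρ : Literature.NumberTheory.GaloisRepresentations.FramedGaloisRep F
(PadicAlgCl p) 6), (13 < p ∧ ρ.toGaloisRep.IsIrreducible ∧ (∀ᶠ v :
IsDedekindDomain.HeightOneSpectrum (NumberField.RingOfIntegers F) in cofinite, ρ.IsUnramifiedAt v) ∧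
ρ.IsOdd ∧ Literature.NumberTheory.GaloisRepresentations.FramedRep.IsGSpValued ρ ∧ (∀ v :
IsDedekindDomain.HeightOneSpectrum (NumberField.RingOfIntegers F), (p : NumberField.RingOfIntegers
F) ∈ v.asIdeal → ρ.IsGreenbergOrdinaryOfShapeAt v ![0, 1, 1, 2, 2, 3] ∧
ρ.IsResiduallyDistinguishedAt v ![0, 1, 1, 2, 2, 3])) → (∀ v : IsDedekindDomain.HeightOneSpectrum
(NumberField.RingOfIntegers F), (p : NumberField.RingOfIntegers F) ∈ v.asIdeal → Nat.card
(NumberField.RingOfIntegers F ⧸ v.asIdeal) = p ∧ (p : NumberField.RingOfIntegers F) ∉ v.asIdeal ^ 2)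
→ Literature.NumberTheory.GaloisRepresentations.FramedRep.HasAbsolutelyIrreducibleReduction
((ρ).restrictField (CyclotomicField p F)) → ∃ (F' : Type) (_ : Field F') (_ : NumberField F') (_ :
Algebra F F') (_ : IsGalois F F'), NumberField.IsTotallyReal F' ∧ (ρ.restrictField
F').toGaloisRep.IsIrreducible ∧ (∃ (hcpt :
Literature.NumberTheory.Automorphic.isCompact_glFiniteIntegralLevel 6 F') (π :
Literature.NumberTheory.Automorphic.CuspidalAutomorphicRepData 6 F' hcpt), π.1.HasHodgeInfinityType
3 {0, 1, 1, 2, 2, 3} ∧ ∀ᶠ v : IsDedekindDomain.HeightOneSpectrum (NumberField.RingOfIntegers F') in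
cofinite, SatakeFrobCompatibleAt ι π.1 (ρ.restrictField F') v)`

## Assembly
Pure logic (sorry-free in the planner's Sketch.lean and in glue.lean, axioms
propext/Classical.choice/Quot.sound): given ρ over F with
the hypotheses of X, MoretBaillySeed yields F' (finite Galois, totally real, p split completely)
with ρ|F' irreducible, ρ̄|Γ_{F'(ζ_p)}
absolutely irreducible and a seed ρ₀; SingularWeightLifting, applied in transported form to (F, ρ,
F'), returns the cuspidal π' on
GL_6(𝔸_{F'}) of Hodge type (3; 0,1,1,2,2,3) matching ρ|F' — this is X (theorem `target_of`);
BeyondTheRung takes LimitWeightGaloisRep and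
X to `Langlands`. Deciding theorem: `closes (hL : SingularWeightLifting) (hS : MoretBaillySeed) (hA
: LimitWeightGaloisRep)
(hB : BeyondTheRung) : _root_.Langlands := hB hA (target_of hL hS)`.

Rationale: WHY THIS LINE. The card's census (Knapp–Zuckerman/Vogan non-degeneracy, host by host; BCGP
arXiv:1812.09269 §1.4.1 print the abelian-surface row,
doi:10.1070/im8431 the discrete-series rows) says a symplectic parameter of rank 2m+2 is
coherent-accessible on the Hodge-type
Shimura variety of GSpin(2,2m+1) iff at most one Hodge–Tate weight is doubled: after Siegel weight
(2,2) (BoxerEtAl2021,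
BoxerCalegariGeePilloni2025, Gee2026) the next rung is weight-3 Hodge type (1,2,2,1), whose
parameter on SO(2,5) has infinitesimal
character (3/2,1/2,1/2), singular on exactly one NON-compact root — a non-degenerate limit of
discrete series living in coherent
cohomology of the GSpin(2,5) fivefold in two adjacent degrees. Direction (B) for this province is
therefore a BCGP-shaped programme
one node over on the Dynkin diagram: higher Hida theory at the singular weight (Pilloni2020,
BoxerPilloni2025,
BoxerPilloni2021HigherColeman) + Calegari–Geraghty patching in defect one (CalegariGeraghty2017) +
Moret-Bailly on a big-monodromy
(1,2,2,1) family (Moretbailly1989, BarnetlambEtAl2014, doi:10.4007/annals.2010.171.779,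
BeukersHeckman1989,
RobertsRodriguezvillegas2022, CandelasEtAl2020) + transfer GL_6 ↔ SO_7 ↔ SO(2,5) (Arthur2013;
arXiv:2301.12143 now gives the
multiplicity formula for the non-quasi-split inner form at generic, possibly non-regular,
parameters) + Galois representations for
the limit-weight forms by strata Hasse invariants (GoldringKoskivirta2019). Imported areas:
representation theory of real groups
(limits of discrete series: KnappZuckerman1982, KnappVogan1995), coherent cohomology of orthogonal
Shimura varieties, arithmetic of
Calabi–Yau / hypergeometric families (MeyerModularCY2005), Rankin–Selberg anchors (KimShahidi2002).
What is new relative to gen 1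
and to the negatives index: the statements use GREENBERG ordinarity (the definition file
CrystallineOrdinaryShape warns that the
gen-1 inlined notion is not even Hodge–Tate for doubled weights), the target is weak potential
automorphy only (the over-reaching
"compatible family at every ℓ" and datum-quantified clauses are gone), and the deciding theorem
reaches the summit statement.

RANKED CRUXES. #0 RungTarget (target) — X of § Thesis — potential weak automorphy, in the right
weight, of the ordinary rank-6 symplectic province of Hodge type (1,2,2,1) over totally real fields
(card cy3-h21-two-gspin-census C2; clients over ℚ: H³ of Calabi–Yau threefolds with h^{2,1} = 2 at
ordinary primes, weight-3 rank-6 hypergeometric motives of Hodge vector (1,2,2,1), anchors ρ_f ⊗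
Sym² ρ_g). Hypotheses, all datum-free: p > 13; ρ irreducible, a.e. unramified, odd (= odd multiplier
for GSp_6, `isOdd_iff_multiplier`), GSp_6-valued; p split completely in F; at every v ∣ p
Greenberg-ordinary of shape (0,1,1,2,2,3) and residually distinguished; ρ̄|Γ_{F(ζ_p)} absolutely
irreducible (Burnside form). Conclusion: ∃ finite Galois totally real F'/F, ρ|F' irreducible, ∃
cuspidal π' on GL_6(𝔸_{F'}) with HasHodgeInfinityType 3 {0,1,1,2,2,3} and a.e.
SatakeFrobCompatibleAt ι π' ρ|F'. (why it might fail: A slice of Fontaine–Mazur–Langlands (B) made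
potential: no counterexample expected; but as typed only absolute irreducibility of ρ̄ (not
vast/tidy/enormous image) is assumed, weaker than every printed engine, so provers may stall where
the statement is still true.) [BoxerEtAl2021, FontaineMazurGeometric1995,
doi:10.4007/annals.2010.171.779, Gee2026]
#2 SingularWeightLifting (crux) — ORDINARY AUTOMORPHY LIFTING IN THE SINGULAR WEIGHT (card S1+S2;
BCGP's lifting theorem one node over on the Dynkin diagram), in TRANSPORTED form F ⊆ F' so that the
glue is pure logic (F' = F is the plain form): ρ : Γ_F → GL_6(ℚ̄_p) over totally real F with the
Galois-side hypotheses of X (p > 13, irreducible, a.e. unramified, odd, GSp_6-valued,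
Greenberg-ordinary of shape (0,1,1,2,2,3) and residually distinguished at v ∣ p); F' ⊇ F totally
real with p split completely in F'; ρ̄|Γ_{F'(ζ_p)} absolutely irreducible; and a SEED over F': ρ₀
a.e. unramified, Greenberg-ordinary of the same shape at every w ∣ p, residually congruent to ρ|F'
(`IsResiduallyCongruent`: charpolys coefficientwise ≡ mod 𝔪, so ρ̄₀ ≅ ρ̄|F' by Brauer–Nesbitt) and
weakly automorphic of Hodge type (3; 0,1,1,2,2,3) ⟹ ρ|F' is weakly automorphic of that Hodge type.
Inside (layer 2, not filed): integral higher Hida theory for the Hodge-type GSpin(2,5) fivefold at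
the limit weight (coherent complex in two adjacent degrees, perfect of length 1 over the weight
algebra, classical in regular weights), Calegari–Geraghty patching in defect 1, doubled-weight
ordinary local deformation rings (components = orderings of the unit roots), an Ihara-avoidance
substitute, local–global compatibility at p for the seed's π₀ (U_p-ordinarity is not part of the
typed seed), adequacy from p > 2(6+1) (Thorne2012). [difficulty: open-problem] (why it might fail:
No higher Hida theory exists for a non-PEL Hodge-type GSpin(2,5) variety at singular weight (print:
modular curve, GSp4, Siegel, Hilbert, unitary; orthogonal patching only in regular weight); BCGP
also needed vast+tidy image and a U_p-ordinary π₀, neither typed here.) [BoxerEtAl2021,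
BoxerCalegariGeePilloni2025, Pilloni2020, BoxerPilloni2025, BoxerPilloni2021HigherColeman,
CalegariGeraghty2017, Thorne2012, Greenberg1991, arXiv:2602.04778]
#3 MoretBaillySeed (crux) — THE MORET-BAILLY STEP (card S3): under the hypotheses of X over F
(including p split completely in F and ρ̄|Γ_{F(ζ_p)} absolutely irreducible) there is a finite
Galois totally real F'/F with p split completely in F', ρ|F' irreducible and ρ̄|Γ_{F'(ζ_p)} still
absolutely irreducible (F' linearly disjoint from the field cut out by ρ̄ and ζ_p), carrying a SEED
ρ₀ exactly as SingularWeightLifting asks (a.e. unramified, Greenberg-ordinary of shape (0,1,1,2,2,3)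
at every w ∣ p, residually congruent to ρ|F', weakly automorphic of Hodge type (3; 0,1,1,2,2,3) for
the given ι). Inside (layer 2): a geometrically irreducible family X → T over an F-rational base
with Hodge vector (1,2,2,1) and mod-p and mod-q monodromy containing Sp_6 (candidates: rank-6
weight-3 hypergeometric local systems — Zariski-dense monodromy by Beukers–Heckman; two-parameter
Calabi–Yau mirror pencils restricted to lines), Moret-Bailly with local conditions (fibre p-adically
close to an ordinary one, q-adically to a residually induced or anchor fibre, every real place), and
SingularWeightLifting at the second prime q to make the fibre automorphic; ρ₀ := H³ of the fibre at
p. [deps: SingularWeightLifting] [difficulty: XL] (why it might fail: HSBT/BLGGT Dwork families give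
only REGULAR seeds; a (1,2,2,1) family with mod-p AND mod-q monodromy onto Sp_6(F_ℓ), ordinary
fibres at p and a residually automorphic fibre at q is unverified (hypergeometric monodromy is only
known Zariski-dense).) [Moretbailly1989, BarnetlambEtAl2014, doi:10.4007/annals.2010.171.779,
BeukersHeckman1989, RobertsRodriguezvillegas2022, CandelasEtAl2020, BoxerEtAl2021]
#4 LimitWeightGaloisRep (crux) — WEAK (A) FOR THE PROVINCE AT ALMOST ALL ℓ (card: "(A) for such π is
Goldring–Koskivirta"): F totally real, π cuspidal on GL_6(𝔸_F) of pure Hodge infinity type (3;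
0,1,1,2,2,3) — NOT regular, the sector of NonRegularWeightBarrier — and essentially self-dual (at
almost every place the Satake parameter α of π and the Satake parameter {c} of a fixed GL_1 datum χ
satisfy {c·α_i⁻¹} = {α_i}, i.e. the unramified shadow of π^∨ ≅ π ⊗ χ⁻¹) ⟹ outside a finite set of
primes ℓ, for every ι : ℚ̄_ℓ ≃ ℂ there is ρ : Γ_F → GL_6(ℚ̄_ℓ) with Satake–Frobenius matching a.e.
Inside (layer 2): symplectic/orthogonal alternative for π; Arthur's transfer GL_6 → SO_7 and
Ishimoto's endoscopic classification for the non-quasi-split inner form SO(2,5) (generic parameters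
of any infinity type); the census line (the archimedean packet at (3/2,1/2,1/2) contains a
NON-DEGENERATE limit of discrete series of SO(2,5), singular on exactly one non-compact root);
realisation in coherent cohomology of the Hodge-type GSpin(2,5) Shimura fivefold in two adjacent
degrees; Goldring–Koskivirta strata Hasse invariants at hyperspecial ℓ. [difficulty: L] (why it
might fail: The NDLDS member must carry (𝔭⁻,K)-cohomology for the right bundle and occur globally
(sign in Ishimoto's multiplicity formula unchecked); Goldring–Koskivirta needs hyperspecial level
and non-PEL conditions (1)-(2); orthogonal-type π with this infinity type ride along untreated.)
[GoldringKoskivirta2019, arXiv:2301.12143, Arthur2013, Taibi2018, KnappZuckerman1982,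
KnappVogan1995, doi:10.1070/im8431, Taylor1991]
#9 BeyondTheRung (support) — COMPLEMENT, NOT THIS ROUTE'S BUSINESS: weak (A) for the province
(LimitWeightGaloisRep) and X (RungTarget), together with everything else in GL_n reciprocity —
de-potentialisation F' ↦ F, local–global compatibility at every finite place, de Rham-ness and
uniqueness, all other n, weights, base fields, residually small images, non-ordinary and non-split p
— give the summit statement. Filed only so that the deciding theorem `closes` literally concludes
`Langlands` (D-0027 §2.1); truth-wise it is the summit minus the province and is attacked by the
structural routes (LiftDescend, BaseFieldAscent, CMFern), never staffed from here. [difficulty: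
open-problem] [BuzzardGeeLMS2014, FontaineMazurGeometric1995]

TWO-LAYER PLAN. Foreseen glued splits (k ≤ 3, depth 1; nothing filed now): SingularWeightLifting ⇐
HigherHidaGSpin25 (ordinary coherent complex at
the limit weight, perfect of length 1, classical in regular weight) → DefectOnePatching (CG patching
of that complex given the seed)
→ SingularWeightLifting; MoretBaillySeed ⇐ BigMonodromyFamily (a (1,2,2,1) family with full mod-p,
mod-q monodromy and the two
local fibres) → FibreAutomorphy (SingularWeightLifting at q for the Moret-Bailly fibre) →
MoretBaillySeed; LimitWeightGaloisRep ⇐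
TransferToGSpin25 (π ↦ cuspidal automorphic representation of GSpin(2,5) with the NDLDS at infinity)
→ CoherentGaloisRep
(Goldring–Koskivirta for that eigenclass) → LimitWeightGaloisRep. Each needs GSpin / orthogonal
Shimura vocabulary in Literature
first (definition requests below); until then provers attach lemmas with `--supports`.

KILL CRITERIA. (k1) If the (𝔭⁻,K)-cohomology computation (Blasius–Harris–Ramakrishnan / Soergel
type) shows that NO member of the SO(2,5) packet at
(3/2,1/2,1/2) contributes to coherent cohomology of the GSpin(2,5) fivefold with any automorphic
bundle, SingularWeightLifting and
LimitWeightGaloisRep lose their only engine: close `exhausted` with the computation attached (the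
card's test 1). (k2) A cuspidal
essentially self-dual π of GL_6 over a totally real field with this infinity type and a provably
transcendental Satake parameter
refutes LimitWeightGaloisRep (and the summit's (A)). (k3) If every candidate (1,2,2,1) family
(rank-6 weight-3 HGM lines, lines in
two-parameter CY mirror families) is shown to have imprimitive or non-surjective mod-ℓ monodromy for
all large ℓ, MoretBaillySeed has
no vehicle: route goes dormant / closes `exhausted`. (k4) A typed refutation of any item by vacuity
(quantifier hygiene, as in the
negatives index) is `misstated`: repair by a new item, never a reworded decl. The three cruxes are
special cases of reciprocity
(truth-wise implied by (A) ∧ (B) plus potential automorphy); a substantive refutation of one of them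
refutes the summit.

NOT DECOMPOSED YET. The census C1 itself (a finite Knapp–Zuckerman table: symplectic rank ≤ 8,
unitary rank ≤ 4, orthogonal K3-type rank ≤ 8) — real-group
representation theory is not in the tree; it rides as rationale and as a Literature-note request.
Higher Hida theory / CG patching /
transfer inside SingularWeightLifting; family + Moret-Bailly + second prime inside MoretBaillySeed;
transfer + coherent realisation +
Hasse invariants inside LimitWeightGaloisRep (layer 2 above). The client side (ordinary primes,
residual images and p-distinguishedness
of concrete h^{2,1} = 2 Calabi–Yau threefolds and (1,2,2,1) hypergeometric motives: certified
numerics, card S6) and the anchor check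
(ρ_f ⊗ Sym² ρ_g satisfies the hypotheses of X and IS automorphic on GL_6 by Kim–Shahidi: an
interface test a grounder can run).
De-potentialisation F' ↦ F, local–global compatibility, every-ℓ families, non-ordinary p: inside
BeyondTheRung / other routes
(LiftDescend, fontaine-operator-order-zero, wach-module-component-census).

CHEAPEST FALSIFIER. The census line for (1,2,2,1): compute the K-types / (𝔭⁻,K)-cohomology of the
limit-of-discrete-series packet of SO(2,5) at
infinitesimal character (3/2,1/2,1/2) (half a page with Knapp–Zuckerman data;
Blasius–Harris–Ramakrishnan's criterion) — if no
member is coherent-cohomological the line is dead in a day. Second cheapest (hours of Magma, kit):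
take one weight-3 rank-6
hypergeometric motive with Hodge vector (1,2,2,1) from the Roberts–Rodriguez-Villegas tables and one
prime 13 < p < 60: is H_p
ordinary with distinct unit roots in both doubled slots and is the mod-p image absolutely
irreducible on Γ_{ℚ(ζ_p)}? A province with
no certified client is not worth staffing. Neither was run in this planner session (no kit in
plancard mode; recorded for refuters).

NUMBERS. n = 6, motivic weight 3, Hodge–Tate multiset {0,1,1,2,2,3} (Hodge vector (1,2,2,1)),
inertial shape (0,1,1,2,2,3), infinitesimal
character of the SO(2,5) parameter (3/2,1/2,1/2), host Shimura variety of dimension 5, coherent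
degrees {i, i+1} (defect l₀ = 1),
p > 13 = 2(6+1) − 1 (adequacy threshold of Thorne2012 / Guralnick–Herzig–Taylor–Thorne for
absolutely irreducible images in
dimension 6), BCGP's engine: p ≥ 3 split completely, weight (2,2), shape (0,0,1,1). Items at open: 6
(target, 3 cruxes, 1 support,
assembly).

DEFINITION REQUESTS. Landed before this route (requested by gen 1, used verbatim here):
FramedRep.IsGSpValued (GSpValued), FramedGaloisRep.IsGreenbergOrdinaryOfShapeAt /
IsResiduallyDistinguishedAt (CrystallineOrdinaryShape), FramedRep.IsResiduallyCongruent /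
HasAbsolutelyIrreducibleReduction
(AbsolutelyIrreducibleReduction), AutomorphicRepData.HasHodgeInfinityType / IsEssentiallySelfDualAE
(HodgeInfinityType). Wanted next
(to be filed by tenure once a crux moves, not load-bearing for the typed layer):
LimitOfDiscreteSeriesData (Knapp–Zuckerman data
(λ, Ψ) on a root datum with a compact/non-compact colouring, non-degeneracy = λ non-singular on
compact roots — pure root-datum
combinatorics over Mathlib's RootPairing) so that the census C1 can be vendored as a Literature
note; GSpinShimuraDatum (Hodge-type
Shimura datum of GSpin(2,n)) for the layer-2 children.

Novelty: Searches (2026-08-15, this session; inherits the card's seven refuter audit passes, ids on the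
card): `lit search --source zbmath
"higher Hida theory" --year-from 2018` (29 rows: modular curve arXiv:2002.06845, GSp_4
doi:10.1215/00127094-2019-0075 /
arXiv:1905.08779, Siegel doi:10.1007/s00222-025-01393-2, Hilbert split arXiv:2106.05666, Drinfeld
arXiv:2507.07423, unitary
P-ordinary arXiv:2409.03783 — no orthogonal / GSpin(2,n) host); `lit search --source zbmath "GSpin
Shimura varieties Galois
representations"` (3: Kret–Shin arXiv:1609.04223, arXiv:2010.08408 — cohomological only;
arXiv:2503.19226); `lit search --source zbmath
"Calabi-Yau threefolds modularity" --year-from 2012` (30 rows: rigid / CM / double octic / attractor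
/ Hilbert pieces; arXiv:2412.14289
Dummigan–Tornaría = the REGULAR rank-4 rung; arXiv:2602.20188 rank-2 attractor; nothing irreducible
of rank 6); `lit search --source
zbmath "potentially modular abelian surfaces"` (9: BCGP; arXiv:2512.04732 READ pp.1-2); `lit
frontier Langlands --since 2023` (30
rows; arXiv:2602.04778 READ abstract+§1); arXiv:2301.12143 READ abstract; `lit search --hybrid`
local (vector leg only, noise);
`lit galaxy search "higher Hida theory" --star all` (0 rows, daemon cache) — galaxy unusable this
session, flagged for the refuter.
Nearest prior art found: doi:10.1007/s10240-021-00128-2 (BCGP: the engine, GSp_4, weight (2,2),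
shape (0,0,1,1)); arXiv:2512.04732
(Chao Gu 2025: the orthogonal rank ≤ 5 rung — K3 of Picard rank ≥ 17 — reduc  [refs: 10.1215/00127094-2019-0075, 10.1007/s00222-025-01393-2, 10.1007/s10240-021-00128-2, 10.1070/im8431, 10.1093/imrn/rnae113, 2002.06845, 1905.08779, 2106.05666, 2507.07423, 2409.03783, 1609.04223, 2010.08408, 2503.19226, 2412.14289, 2602.20188, 2512.04732, 2602.04778, 2301.12143, doi:10.1215/00127094-2019-0075, doi:10.1007/s00222-025-01393-2, doi:10.1007/s10240-021-00128-2, doi:10.1070/im8431, doi:10]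

Barriers (technique_class: taylor-wiles coherent-cohomology limits-of-discrete-series): - technique_class: taylor-wiles coherent-cohomology limits-of-discrete-series
- Literature.Barriers.Langlands.NonRegularWeightBarrier: APPLIES (weights 1 and 2 doubled;
`HasHodgeInfinityType 3 {0,1,1,2,2,3}` is never regular algebraic,
`not_isRegular_of_isPureOfHodgeType_weightThree`) and is evaded exactly by the barrier's recorded
evasion — coherent cohomology of a Shimura variety in a range of degrees for a NON-DEGENERATE limit
of discrete series (GSpin(2,5) fivefold, two adjacent degrees) with p-adic interpolation by higher
Hida theory instead of Betti cohomology; the census says where this evasion stops (a compact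
singular root: abelian threefolds, (1,3,3,1), (2,2,2,2) are NOT claimed).
- Literature.Barriers.Langlands.TaylorWilesNumericalCoincidence: APPLIES to SingularWeightLifting
(defect l₀ = 1: the eigensystem lives in two coherent degrees) and is evaded as in BCGP by
Calegari–Geraghty patching of a perfect length-1 complex, never a defect-zero R = T; the
regular-weight orthogonal R = T of arXiv:2602.04778 is the defect-zero neighbour, not used.
- Literature.Barriers.Langlands.TaylorWilesNumericalCoincidenceNarrow: same engagement and evasion
(positive-defect patching over the higher Hida complex; ρ is GSp_6-valued and odd over a totally
real field, so the self-dual form of the coincidence holds up to the defect).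
- Literature.Barriers.Langlands.ResiduallyReducibleBarrier: NOT evaded — absolute irreducibility of
ρ̄|Γ_{F(ζ_p)} (Burnside form) and p > 13 are explicit hy

History (route lifecycle, newest last):
- 2026-08-22T15:39:30Z · DORMANT — reconciler: no traction for 5.5 d (last activity item-evidence-added at 2026-08-17T04:13:53Z); parked, not closed — `ledger route dormant route-Langlands-GSpinC (operator:999:4098407)

sub-problem: Langlands · status: dormant · opened planner-plancard-Langlands-Langlands-cy3-h21--908f5ee3-g2-0 2026-08-15T18:46:47Z · rev 3 · ledger route-Langlands-GSpinCensusRung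
GENERATED by the gate from the ledger (D-0016/17). Provers cite these decls: `theorem foo : Summit.Langlands.Langlands.Theses.GSpinCensusRung.<Decl> := …` in Summits/Langlands/Langlands/Theorems/<Name>.lean.
-/

namespace Summit.Langlands.Langlands.Theses.GSpinCensusRung

open scoped BigOperators Topology Manifold Classical MeasureTheory ProbabilityTheory Matrix InnerProductSpace ComplexConjugate ContinuousMap
open Filter Set Function TopologicalSpace MeasureTheory

attribute [summit_statement] _root_.Langlands

/-- item stmt-Langlands-11942 · target · rank 0 · open · by planner
why it might fail: True under FM+reciprocity with the HT↔infinity-type recipe (not a literal corollary of `Langlands`, which omits it); as a theorem the seed step needs a ℚ_p-fibre of a thin (1,2,2,1) family matching generic ρ̄|Γ_Fv with p split completely (impossible by counting); only abs.-irreducible ρ̄ assumed.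
sources: BoxerEtAl2021, FontaineMazurGeometric1995, doi:10.4007/annals.2010.171.779, Gee2026, BuzzardGeeLMS2014
[target] X of § Thesis — potential weak automorphy, in the right weight, of the ordinary rank-6
symplectic province of Hodge type (1,2,2,1) over totally real fields (card cy3-h21-two-gspin-census
C2; clients over ℚ: H³ of Calabi–Yau threefolds with h^{2,1} = 2 at ordinary primes, weight-3 rank-6
hypergeometric motives of Hodge vector (1,2,2,1), anchors ρ_f ⊗ Sym² ρ_g). Hypotheses, all
datum-free: p > 13; ρ irreducible, a.e. unramified, odd (= odd multiplier for GSp_6,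
`isOdd_iff_multiplier`), GSp_6-valued; p split completely in F; at every v ∣ p Greenberg-ordinary of
shape (0,1,1,2,2,3) and residually distinguished; ρ̄|Γ_{F(ζ_p)} absolutely irreducible (Burnside
form). Conclusion: ∃ finite Galois totally real F'/F, ρ|F' irreducible, ∃ cuspidal π' on
GL_6(𝔸_{F'}) with HasHodgeInfinityType 3 {0,1,1,2,2,3} and a.e. SatakeFrobCompatibleAt ι π' ρ|F'. -/
@[route_item "route-Langlands-GSpinCensusRung"]
def RungTarget : Prop :=
  ∀ (F : Type) [Field F] [NumberField F] [NumberField.IsTotallyReal F] (p : ℕ) [Fact p.Prime] (ι : PadicAlgCl p ≃+* ℂ) (ρ : Literature.NumberTheory.GaloisRepresentations.FramedGaloisRep F (PadicAlgCl p) 6), (13 < p ∧ ρ.toGaloisRep.IsIrreducible ∧ (∀ᶠ v : IsDedekindDomain.HeightOneSpectrum (NumberField.RingOfIntegers F) in cofinite, ρ.IsUnramifiedAt v) ∧ ρ.IsOdd ∧ Literature.NumberTheory.GaloisRepresentations.FramedRep.IsGSpValued ρ ∧ (∀ v : IsDedekindDomain.HeightOneSpectrum (NumberField.RingOfIntegers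 F), (p : NumberField.RingOfIntegers F) ∈ v.asIdeal → ρ.IsGreenbergOrdinaryOfShapeAt v ![0, 1, 1, 2, 2, 3] ∧ ρ.IsResiduallyDistinguishedAt v ![0, 1, 1, 2, 2, 3])) → (∀ v : IsDedekindDomain.HeightOneSpectrum (NumberField.RingOfIntegers F), (p : NumberField.RingOfIntegers F) ∈ v.asIdeal → Nat.card (NumberField.RingOfIntegers F ⧸ v.asIdeal) = p ∧ (p : NumberField.RingOfIntegers F) ∉ v.asIdeal ^ 2) → Literature.NumberTheory.GaloisRepresentations.FramedRep.HasAbsolutelyIrreducibleReduction ((ρ).restrictField (CyclotomicField p F)) → ∃ (F' : Type) (_ : Field F') (_ : NumberField F') (_ : Algebra F F') (_ : IsGalois F F'), NumberField.IsTotallyReal F' ∧ (ρ.restrictField F').toGaloisRep.IsIrreducible ∧ (∃ (hcpt : Literature.NumberTheory.Automorphic.isCompact_glFiniteIntegralLevel 6 F') (π : Literature.NumberTheory.Automorphic.CuspidalAutomorphicRepData 6 F' hcpt), π.1.HasHodgeInfinityType 3 {0, 1, 1, 2, 2, 3} ∧ ∀ᶠ v : IsDedekindDomain.HeightOneSpectrum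 (NumberField.RingOfIntegers F') in cofinite, SatakeFrobCompatibleAt ι π.1 (ρ.restrictField F') v)

/-- item stmt-Langlands-11943 · crux · rank 2 · open · by planner
why it might fail: No higher Hida theory or defect-1 CG patching exists for the non-PEL Hodge-type GSpin(2,5) fivefold at singular weight (3/2,1/2,1/2), whose NDLDS are non-holomorphic (coherent H¹/H², not BCGP's H⁰/H¹); typed seed need not be symplectic-type or U_p-ordinary on GSpin₇; ρ̄ only abs. irreducible.
sources: BoxerEtAl2021, BoxerCalegariGeePilloni2025, Pilloni2020, BoxerPilloni2025, BoxerPilloni2021HigherColeman, CalegariGeraghty2017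
[crux] ORDINARY AUTOMORPHY LIFTING IN THE SINGULAR WEIGHT (card S1+S2; BCGP's lifting theorem one
node over on the Dynkin diagram), in TRANSPORTED form F ⊆ F' so that the glue is pure logic (F' = F
is the plain form): ρ : Γ_F → GL_6(ℚ̄_p) over totally real F with the Galois-side hypotheses of X (p
> 13, irreducible, a.e. unramified, odd, GSp_6-valued, Greenberg-ordinary of shape (0,1,1,2,2,3) and
residually distinguished at v ∣ p); F' ⊇ F totally real with p split completely in F';
ρ̄|Γ_{F'(ζ_p)} absolutely irreducible; and a SEED over F': ρ₀ a.e. unramified, Greenberg-ordinary of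
the same shape at every w ∣ p, residually congruent to ρ|F' (`IsResiduallyCongruent`: charpolys
coefficientwise ≡ mod 𝔪, so ρ̄₀ ≅ ρ̄|F' by Brauer–Nesbitt) and weakly automorphic of Hodge type (3;
0,1,1,2,2,3) ⟹ ρ|F' is weakly automorphic of that Hodge type. Inside (layer 2, not filed): integral
higher Hida theory for the Hodge-type GSpin(2,5) fivefold at the limit weight (coherent complex in
two adjacent degrees, perfect of length 1 over the weight algebra, classical in regular weights),
Calegari–Geraghty patching in defect 1, doubled-weight ordinary local deformation rings (components
= orderings of the -/
@[route_item "route-Langlands-GSpinCensusRung", crux]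
def SingularWeightLifting : Prop :=
  ∀ (F : Type) [Field F] [NumberField F] [NumberField.IsTotallyReal F] (p : ℕ) [Fact p.Prime] (ι : PadicAlgCl p ≃+* ℂ) (ρ : Literature.NumberTheory.GaloisRepresentations.FramedGaloisRep F (PadicAlgCl p) 6) (F' : Type) [Field F'] [NumberField F'] [NumberField.IsTotallyReal F'] [Algebra F F'], (13 < p ∧ ρ.toGaloisRep.IsIrreducible ∧ (∀ᶠ v : IsDedekindDomain.HeightOneSpectrum (NumberField.RingOfIntegers F) in cofinite, ρ.IsUnramifiedAt v) ∧ ρ.IsOdd ∧ Literature.NumberTheory.GaloisRepresentations.FramedRep.IsGSpValued ρ ∧ (∀ v : IsDedekindDomain.HeightOneSpectrum (NumberField.RingOfIntegers F), (p : NumberField.RingOfIntegers F) ∈ v.asIdeal → ρ.IsGreenbergOrdinaryOfShapeAt v ![0, 1, 1, 2, 2, 3] ∧ ρ.IsResiduallyDistinguishedAt v ![0, 1, 1, 2, 2, 3])) → (∀ v : IsDedekindDomain.HeightOneSpectrum (NumberField.RingOfIntegers F'), (p : NumberField.RingOfIntegers F') ∈ v.asIdeal → Nat.card (NumberField.RingOfIntegers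 F' ⧸ v.asIdeal) = p ∧ (p : NumberField.RingOfIntegers F') ∉ v.asIdeal ^ 2) → Literature.NumberTheory.GaloisRepresentations.FramedRep.HasAbsolutelyIrreducibleReduction ((ρ.restrictField F').restrictField (CyclotomicField p F')) → (∃ ρ₀ : Literature.NumberTheory.GaloisRepresentations.FramedGaloisRep F' (PadicAlgCl p) 6, (∀ᶠ v : IsDedekindDomain.HeightOneSpectrum (NumberField.RingOfIntegers F') in cofinite, ρ₀.IsUnramifiedAt v) ∧ (∀ v : IsDedekindDomain.HeightOneSpectrum (NumberField.RingOfIntegers F'), (p : NumberField.RingOfIntegers F') ∈ v.asIdeal → ρ₀.IsGreenbergOrdinaryOfShapeAt v ![0, 1, 1, 2, 2, 3]) ∧ Literature.NumberTheory.GaloisRepresentations.FramedRep.IsResiduallyCongruent (ρ.restrictField F') ρ₀ ∧ (∃ (hcpt : Literature.NumberTheory.Automorphic.isCompact_glFiniteIntegralLevel 6 F') (π : Literature.NumberTheory.Automorphic.CuspidalAutomorphicRepData 6 F' hcpt), π.1.HasHodgeInfinityType 3 {0, 1, 1, 2, 2, 3} ∧ ∀ᶠ v : IsDedekindDomain.HeightOneSpectrum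 (NumberField.RingOfIntegers F') in cofinite, SatakeFrobCompatibleAt ι π.1 (ρ₀) v)) → (∃ (hcpt : Literature.NumberTheory.Automorphic.isCompact_glFiniteIntegralLevel 6 F') (π : Literature.NumberTheory.Automorphic.CuspidalAutomorphicRepData 6 F' hcpt), π.1.HasHodgeInfinityType 3 {0, 1, 1, 2, 2, 3} ∧ ∀ᶠ v : IsDedekindDomain.HeightOneSpectrum (NumberField.RingOfIntegers F') in cofinite, SatakeFrobCompatibleAt ι π.1 (ρ.restrictField F') v)

/-- item stmt-Langlands-11944 · crux · rank 3 · open · by planner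
why it might fail: Typed: p split completely in F′ and ρ̄₀≅ρ̄|F′ ⇒ Moret-Bailly needs an ordinary ℚ_p-fibre with M_t[p]|Γ_ℚp≅ρ̄|Γ_Fv; unit-root characters of M_t[p] depend on t mod p (≤p² triples vs ~p³ needed), so HGM lines / h²¹=2 pencils miss generic ρ̄_v (BCGP: Serre–Tate-universal A₂); q-fibre automorphy=rank 2.
sources: Moretbailly1989, doi:10.4007/annals.2010.171.779, BarnetlambEtAl2014, BoxerEtAl2021, BeukersHeckman1989, RobertsRodriguezvillegas2022
[crux] THE MORET-BAILLY STEP (card S3): under the hypotheses of X over F (including p split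
completely in F and ρ̄|Γ_{F(ζ_p)} absolutely irreducible) there is a finite Galois totally real F'/F
with p split completely in F', ρ|F' irreducible and ρ̄|Γ_{F'(ζ_p)} still absolutely irreducible (F'
linearly disjoint from the field cut out by ρ̄ and ζ_p), carrying a SEED ρ₀ exactly as
SingularWeightLifting asks (a.e. unramified, Greenberg-ordinary of shape (0,1,1,2,2,3) at every w ∣
p, residually congruent to ρ|F', weakly automorphic of Hodge type (3; 0,1,1,2,2,3) for the given ι).
Inside (layer 2): a geometrically irreducible family X → T over an F-rational base with Hodge vector
(1,2,2,1) and mod-p and mod-q monodromy containing Sp_6 (candidates: rank-6 weight-3 hypergeometric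
local systems — Zariski-dense monodromy by Beukers–Heckman; two-parameter Calabi–Yau mirror pencils
restricted to lines), Moret-Bailly with local conditions (fibre p-adically close to an ordinary one,
q-adically to a residually induced or anchor fibre, every real place), and SingularWeightLifting at
the second prime q to make the fibre automorphic; ρ₀ := H³ of the fibre at p. [deps:
SingularWeightLifting] [difficul -/
@[route_item "route-Langlands-GSpinCensusRung", crux]
def MoretBaillySeed : Prop :=
  ∀ (F : Type) [Field F] [NumberField F] [NumberField.IsTotallyReal F] (p : ℕ) [Fact p.Prime] (ι : PadicAlgCl p ≃+* ℂ) (ρ : Literature.NumberTheory.GaloisRepresentations.FramedGaloisRep F (PadicAlgCl p) 6), (13 < p ∧ ρ.toGaloisRep.IsIrreducible ∧ (∀ᶠ v : IsDedekindDomain.HeightOneSpectrum (NumberField.RingOfIntegers F) in cofinite, ρ.IsUnramifiedAt v) ∧ ρ.IsOdd ∧ Literature.NumberTheory.GaloisRepresentations.FramedRep.IsGSpValued ρ ∧ (∀ v : IsDedekindDomain.HeightOneSpectrum (NumberField.RingOfIntegers F), (p : NumberField.RingOfIntegers F) ∈ v.asIdeal → ρ.IsGreenbergOrdinaryOfShapeAt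 v ![0, 1, 1, 2, 2, 3] ∧ ρ.IsResiduallyDistinguishedAt v ![0, 1, 1, 2, 2, 3])) → (∀ v : IsDedekindDomain.HeightOneSpectrum (NumberField.RingOfIntegers F), (p : NumberField.RingOfIntegers F) ∈ v.asIdeal → Nat.card (NumberField.RingOfIntegers F ⧸ v.asIdeal) = p ∧ (p : NumberField.RingOfIntegers F) ∉ v.asIdeal ^ 2) → Literature.NumberTheory.GaloisRepresentations.FramedRep.HasAbsolutelyIrreducibleReduction ((ρ).restrictField (CyclotomicField p F)) → ∃ (F' : Type) (_ : Field F') (_ : NumberField F') (_ : Algebra F F') (_ : IsGalois F F'), NumberField.IsTotallyReal F' ∧ (ρ.restrictField F').toGaloisRep.IsIrreducible ∧ (∀ v : IsDedekindDomain.HeightOneSpectrum (NumberField.RingOfIntegers F'), (p : NumberField.RingOfIntegers F') ∈ v.asIdeal → Nat.card (NumberField.RingOfIntegers F' ⧸ v.asIdeal) = p ∧ (p : NumberField.RingOfIntegers F') ∉ v.asIdeal ^ 2) ∧ Literature.NumberTheory.GaloisRepresentations.FramedRep.HasAbsolutelyIrreducibleReduction ((ρ.restrictField F').restrictField (CyclotomicField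 p F')) ∧ (∃ ρ₀ : Literature.NumberTheory.GaloisRepresentations.FramedGaloisRep F' (PadicAlgCl p) 6, (∀ᶠ v : IsDedekindDomain.HeightOneSpectrum (NumberField.RingOfIntegers F') in cofinite, ρ₀.IsUnramifiedAt v) ∧ (∀ v : IsDedekindDomain.HeightOneSpectrum (NumberField.RingOfIntegers F'), (p : NumberField.RingOfIntegers F') ∈ v.asIdeal → ρ₀.IsGreenbergOrdinaryOfShapeAt v ![0, 1, 1, 2, 2, 3]) ∧ Literature.NumberTheory.GaloisRepresentations.FramedRep.IsResiduallyCongruent (ρ.restrictField F') ρ₀ ∧ (∃ (hcpt : Literature.NumberTheory.Automorphic.isCompact_glFiniteIntegralLevel 6 F') (π : Literature.NumberTheory.Automorphic.CuspidalAutomorphicRepData 6 F' hcpt), π.1.HasHodgeInfinityType 3 {0, 1, 1, 2, 2, 3} ∧ ∀ᶠ v : IsDedekindDomain.HeightOneSpectrum (NumberField.RingOfIntegers F') in cofinite, SatakeFrobCompatibleAt ι π.1 (ρ₀) v))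

/-- item stmt-Langlands-11945 · crux · rank 4 · open · by planner
why it might fail: Irregular (A) on GL₆ unproved: the SO(2,5) packet at (3/2,1/2,1/2) has no holomorphic member (e₂−e₃ compact in the e₁-extreme chamber), so classes sit in coherent H¹/H² of a non-PEL fivefold, outside Goldring–Koskivirta (H⁰) and Pilloni–Stroh/Boxer (PEL); orthogonal π included; U(3,3) way unbuilt.
sources: GoldringKoskivirta2019, arXiv:2301.12143, Arthur2013, Taibi2018, Mok2014, Sorensen2020
[crux] WEAK (A) FOR THE PROVINCE AT ALMOST ALL ℓ (card: "(A) for such π is Goldring–Koskivirta"): F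
totally real, π cuspidal on GL_6(𝔸_F) of pure Hodge infinity type (3; 0,1,1,2,2,3) — NOT regular,
the sector of NonRegularWeightBarrier — and essentially self-dual (at almost every place the Satake
parameter α of π and the Satake parameter {c} of a fixed GL_1 datum χ satisfy {c·α_i⁻¹} = {α_i},
i.e. the unramified shadow of π^∨ ≅ π ⊗ χ⁻¹) ⟹ outside a finite set of primes ℓ, for every ι : ℚ̄_ℓ
≃ ℂ there is ρ : Γ_F → GL_6(ℚ̄_ℓ) with Satake–Frobenius matching a.e. Inside (layer 2):
symplectic/orthogonal alternative for π; Arthur's transfer GL_6 → SO_7 and Ishimoto's endoscopic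
classification for the non-quasi-split inner form SO(2,5) (generic parameters of any infinity type);
the census line (the archimedean packet at (3/2,1/2,1/2) contains a NON-DEGENERATE limit of discrete
series of SO(2,5), singular on exactly one non-compact root); realisation in coherent cohomology of
the Hodge-type GSpin(2,5) Shimura fivefold in two adjacent degrees; Goldring–Koskivirta strata Hasse
invariants at hyperspecial ℓ. [difficulty: L] -/
@[route_item "route-Langlands-GSpinCensusRung", crux]
def LimitWeightGaloisRep : Prop :=
  ∀ (F : Type) [Field F] [NumberField F] [NumberField.IsTotallyReal F] (hcpt : Literature.NumberTheory.Automorphic.isCompact_glFiniteIntegralLevel 6 F) (π : Literature.NumberTheory.Automorphic.CuspidalAutomorphicRepData 6 F hcpt), π.1.HasHodgeInfinityType 3 {0, 1, 1, 2, 2, 3} → (∃ (h₁ : Literature.NumberTheory.Automorphic.isCompact_glFiniteIntegralLevel 1 F) (χ : Literature.NumberTheory.Automorphic.CuspidalAutomorphicRepData 1 F h₁), ∀ᶠ v : IsDedekindDomain.HeightOneSpectrum (NumberField.RingOfIntegers F) in cofinite, ∃ α β : Multiset ℂ, π.1.HasSatakeParamAt v α ∧ χ.1.HasSatakeParamAt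 v β ∧ ∃ c ∈ β, α.map (fun z => c * z⁻¹) = α) → ∃ S : Finset ℕ, ∀ (ℓ : ℕ) [Fact ℓ.Prime], ℓ ∉ S → ∀ (ι : PadicAlgCl ℓ ≃+* ℂ), ∃ ρ : Literature.NumberTheory.GaloisRepresentations.FramedGaloisRep F (PadicAlgCl ℓ) 6, ∀ᶠ v : IsDedekindDomain.HeightOneSpectrum (NumberField.RingOfIntegers F) in cofinite, SatakeFrobCompatibleAt ι π.1 ρ v

/-- item stmt-Langlands-11946 · support · rank 9 · open · by planner
sources: BuzzardGeeLMS2014, FontaineMazurGeometric1995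
[support] COMPLEMENT, NOT THIS ROUTE'S BUSINESS: weak (A) for the province (LimitWeightGaloisRep)
and X (RungTarget), together with everything else in GL_n reciprocity — de-potentialisation F' ↦ F,
local–global compatibility at every finite place, de Rham-ness and uniqueness, all other n, weights,
base fields, residually small images, non-ordinary and non-split p — give the summit statement.
Filed only so that the deciding theorem `closes` literally concludes `Langlands` (D-0027 §2.1);
truth-wise it is the summit minus the province and is attacked by the structural routes
(LiftDescend, BaseFieldAscent, CMFern), never staffed from here. [difficulty: open-problem] -/
@[route_item "route-Langlands-GSpinCensusRung", crux]
def BeyondTheRung : Prop :=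
  LimitWeightGaloisRep → RungTarget → _root_.Langlands

/-- item stmt-Langlands-14392 · support · rank 9 · open · by planner
sources: BoxerEtAl2021, BuzzardGeeLMS2014
[support] GLUE TO THE TARGET (pure logic; gate badge route.target-unreachable): the two (B)-side
cruxes give X = RungTarget — given ρ over F with the hypotheses of X, MoretBaillySeed yields a
finite Galois totally real F'/F with p split completely in F', ρ|F' irreducible, ρ̄|Γ_{F'(ζ_p)}
absolutely irreducible and a seed ρ₀ over F'; SingularWeightLifting in its transported form (F, ρ,
F') then returns the cuspidal π' on GL_6(𝔸_{F'}) of Hodge infinity type (3; 0,1,1,2,2,3) with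
Satake–Frobenius matching for ρ|F' almost everywhere. This is exactly the composition the deciding
theorem `closes` performs inline (`hB hA (target_of hL hS)`); it is filed as an item so that the
route's item graph reaches the target. Provable now, term checked in the planner's Sketch.lean:
`intro hL hS F _ _ _ p _ ι ρ hcore hsplit hres; obtain ⟨F', iF, iN, iA, iG, hTR, hirr, hsplit',
hres', hseed⟩ := hS F p ι ρ hcore hsplit hres; haveI := hTR; exact ⟨F', iF, iN, iA, iG, hTR, hirr,
hL F p ι ρ F' hcore hsplit' hres' hseed⟩`. [deps: SingularWeightLifting, MoretBaillySeed,
RungTarget] [difficulty: provable-now] -/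
@[route_item "route-Langlands-GSpinCensusRung"]
def RungTargetGlue : Prop :=
  SingularWeightLifting → MoretBaillySeed → RungTarget

/-- item stmt-Langlands-11947 · assembly · rank 1 · open · by planner
sources: BoxerEtAl2021, BuzzardGeeLMS2014
[assembly] SingularWeightLifting → MoretBaillySeed → LimitWeightGaloisRep → BeyondTheRung →
Langlands. -/
@[route_item "route-Langlands-GSpinCensusRung"]
def Assembly : Prop :=
  SingularWeightLifting → MoretBaillySeed → LimitWeightGaloisRep → BeyondTheRung → _root_.Langlands

/-! D-0027 §2.1 — DECIDING THEOREM (planner-authored via `route open/edit --closes-file`; by planner-plancard-Langlands-Langlands-cy3-h21--908f5ee3-g2-0 2026-08-15T18:46:48Z):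
its hypotheses are this route's items and its conclusion the sub-problem Statement (glue_lint), and it elaborates with this file. -/

@[closes "route-Langlands-GSpinCensusRung"] theorem closes (hL : SingularWeightLifting) (hS : MoretBaillySeed) (hA : LimitWeightGaloisRep)
    (hB : BeyondTheRung) : _root_.Langlands := by
  refine hB hA ?_
  intro F _ _ _ p _ ι ρ hcore hsplit hres
  obtain ⟨F', iF, iN, iA, iG, hTR, hirr, hsplit', hres', hseed⟩ := hS F p ι ρ hcore hsplit hres
  haveI := hTR
  exact ⟨F', iF, iN, iA, iG, hTR, hirr, hL F p ι ρ F' hcore hsplit' hres' hseed⟩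

end Summit.Langlands.Langlands.Theses.GSpinCensusRung
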